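/-
Copyright: b2b-lace packet (explicit-unit carver, gen 19).  [FvdH17] App. B "Building blocks with weight" and §5.1
"Elements of the bounds": the WEIGHTED building blocks `H^{(1)}, H^{(2)}, H^{(3)}, C^{(1)}, C^{(2)}`, `h^{ι,κ,b}`,
`h^{ι,κ,II,b}`, their matrices `(C^{(1)}), (C^{(2)}), (H^{(1)}), (H^{(2)}), (H^{(3)})` and vectors `h^S, h^E, P^ι, h^ι, h^{ι,II}`,
typed over the letter interface of `NobleBlocks`.  Definitions and kernel lemmas only; no named fact; no numeral; no
dimension is fixed.
-/
import Literature.Probability.FitznerVanDerHofstad2017.NobleBlocks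
import Literature.Barriers.CriticalPhenomena.LaceExpansionHighDimension
import HarnessLib

/-!
# [FvdH17] App. B / §5.1: the weighted building blocks of the NoBLE bounds

Source: R. Fitzner, R. van der Hofstad, *Mean-field behavior for nearest-neighbor percolation in `d > 10`*,
Electron. J. Probab. **22** (2017) no. 43 [FvdH17]; arXiv:1506.07977v2, Appendix B "Building blocks with weight"
(TeX source `PercPaper_arxiv2017.tex` l.10605–10623) and §5.1 "Elements of the bounds" (l.9338–9372; v2 pp. 49–50).

Verbatim (App. B): "To bound `Σ_x ‖x‖₂² Ξ^{(N)}_z(x)` we define weighted diagrams. These are diagrams in which one line has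
the weight `‖x‖₂²`. […] For `a, b ∈ {0,1,2}`, let
`H^{(1),a,b}(u,v,x,y) = ‖u−x‖₂² Ā^{a,b}(u,v,x,y)`, `H^{(2),ι,a,b}(u,v,x,y) = ‖u−x‖₂² Ā^{ι,a,b,*}(u,v,x,y)`,
`H^{(3),ι,a,b}(u,v,x,y) = ‖v−y‖₂² Ā^{ι,a,b,*}(u,v,x,y)`, and
`C^{(1),ι,κ,a,b}(0,v,x,y) = Σ_{c=0}^2 Σ_{w,u} B^{ι,a,c}(0,v,w,u) Ā^{κ,c,b}(u,w,y,x) ‖w‖₂²`,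
`C^{(2),ι,κ,a,b}(0,v,x,y) = Σ_{c=0}^2 Σ_{w,u} B^{ι,a,c}(v,0,u,w) Ā^{κ,c,b}(w,u,x,y) ‖u‖₂²`."
Verbatim (§5.1): "`h^{ι,κ,b}(x,y) = Σ_{a=0}^2 Σ_{u,v} (δ_{0,a} δ_{κ,ι} δ_{0,u} δ_{0,v} + P^{ι,a}(u,v)) Ā^{κ,a,b}(u,v,x,y) ‖x − e_ι‖₂²`",
(5.7) "`h^{ι,κ,II,b}(x,y) = h^{ι,κ,b}(x,y) + Σ_{c=0}^2 Σ_{w,t} A^{ι,0,c}(0,0,w,t) Σ_{κ₂} Ā^{κ₂,c,b,*}(t,w,y,x) ‖x−e_ι‖₂²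
 + Σ_{a,c=0}^2 Σ_{u,v,w,t} P^{ι,a}(u,v) A^{κ,a,c}(u,v,w,t) Σ_{κ₂} Ā^{κ₂,c,b,*}(t,w,y,x) ‖x−e_ι‖₂²`", and the entries
"`(C^{(i)})_{a,b} = sup_{v,y} Σ_{ι,κ,x} C^{(i),ι,κ,a,b}(0,v,x,x+y)` (`i = 1,2`), `(H^{(1)})_{a,b} = sup_{v,y} Σ_x H^{(1),a,b}(0,v,x,x+y)`,
`(H^{(2)})_{a,b} = sup_{v,y} Σ_{ι,x} H^{(2),ι,a,b}(0,v,x,x+y)`, `(H^{(3)})_{a,b} = sup_{v,y} Σ_{ι,x} H^{(3),ι,a,b}(0,v,x+y,y)`,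
`(h^S)_b = (H^{(1)})_{0,b}`, `(h^E)_b = (H^{(3)})_{0,b}`", "`(P^ι)_b = (1/2d)[δ_{0,b} + Σ_{ι,x,y} P^{ι,b}(x,y)]`,
`(h^ι)_b = (1/2d) Σ_{ι,κ,x,y} h^{ι,κ,b}(x,y)`, `(h^{ι,II})_b = (1/2d) Σ_{ι,κ,x,y} h^{ι,κ,II,b}(x,y)`."

## Lean rendering (reading notes; DIVERGENCE D66 (g)–(k) of the b2b-lace packet)
* (g) `Ā^{a,b}` WITHOUT a direction superscript (in `H^{(1)}`) is not defined in print (App. B.1 defines `A^{a,b}`,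
  `A^{a,b,*}`, `A^{ι,a,b}`, `A^{ι,a,b,*}`, `Ā^{ι,a,b}`, `Ā^{ι,a,b,*}` only); it enters here as a PARAMETER
  `Abar0 : PlainBlockFamily d` of `blockH1`/`matH1`/`vechS`, to be fixed by a reading decision (Q-N76-1).
* (h) The weight `‖z‖₂²` is `wt z = ENNReal.ofReal (euclidNorm z ^ 2)` (`euclidNorm` as in `nobleH`, the tree's `‖·‖₂`).
* (i) `C^{(1)}`, `C^{(2)}` are printed with first argument `0`; they are typed as `0`-anchored bases `blockC1₀`/`blockC2₀`
  extended translation-invariantly by `NobleBlocks.ofBase` (the weight `‖w‖₂²` becomes `‖w − t‖₂²` at anchor `t`),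
  exactly as the unweighted blocks of `NobleBlocks`.  The argument orders `Ā^{κ,c,b}(u,w,y,x)` in `C^{(1)}` and
  `B^{ι,a,c}(v,0,u,w)` in `C^{(2)}` are typed AS PRINTED.  `B^{ι,a,c}` is the composite `NobleBlocks.blockB L B2` with
  its `B^{(2)}` parameter.
* (j) `(H^{(3)})_{a,b}` carries the argument pattern `(0,v,x+y,y)` (not `(0,v,x,x+y)`): typed as printed by the norm
  `normOW`; `(H^{(1)})`, `(H^{(2)})`, `(C^{(i)})` use `BlockSummation.normOO` (`(0,v,x,x+y)`).
* (k) In `h^{ι,κ,II,b}` the direction-superscripted `A^{κ,a,c}(u,v,w,t)` is `blockAiota L κ a c`, and `A^{ι,0,c}(0,0,w,t)`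
  is `blockAiota L ι 0 c 0 0 w t`; the Kronecker prefactor `δ_{0,a} δ_{κ,ι} δ_{0,u} δ_{0,v}` is `kdeltaPref`.
NOT in this module: any bound on these objects (App. D of [FvdH17-ext] / [Fit13] Ch. 4), the propositions of §5.3,
and every numerical value.
-/

noncomputable section

namespace Literature.Probability.FitznerVanDerHofstad2017.NobleBlocks

open Literature.Probability.LatticeModels Literature.Probability.Percolation
open Literature.Probability.FitznerVanDerHofstad2017.BlockSummation
open Literature.Barriers.CriticalPhenomena (euclidNorm euclidNorm_nonneg euclidNorm_single)
open scoped BigOperators ENNReal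

variable {d : ℕ}

local notation "𝐞" => Literature.Probability.Percolation.stepVec

/-! ### A. The weight `‖z‖₂²` -/

/-- The weight `‖z‖₂²` of a weighted line, in `ℝ≥0∞`. [cite: FitznerVanDerHofstad2017, App. B "Building blocks with weight" (arXiv:1506.07977v2 TeX l.10605–10612)] -/
def wt (z : Site d) : ℝ≥0∞ := ENNReal.ofReal (euclidNorm z ^ 2)

/-- `‖0‖₂² = 0`. [folklore] -/
@[simp] theorem wt_zero : wt (0 : Site d) = 0 := by
  simp [wt, euclidNorm]

/-- `‖−z‖₂² = ‖z‖₂²`. [folklore] -/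
theorem wt_neg (z : Site d) : wt (-z) = wt z := by
  simp [wt, euclidNorm]

/-- `‖x − y‖₂² = ‖y − x‖₂²`. [folklore] -/
theorem wt_sub_comm (x y : Site d) : wt (x - y) = wt (y - x) := by
  rw [← neg_sub, wt_neg]

/-- `‖e_i‖₂² = 1` for a coordinate vector. [folklore] -/
theorem wt_single_one (i : Fin d) : wt (Pi.single i (1 : ℤ) : Site d) = 1 := by
  simp [wt, euclidNorm_single]

/-- `‖e_ι‖₂² = 1`. [folklore] -/
theorem wt_stepVec (ι : Fin d × Bool) : wt (𝐞 ι : Site d) = 1 := by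
  unfold stepVec
  split_ifs
  · exact wt_single_one ι.1
  · rw [wt_neg]; exact wt_single_one ι.1

/-- A translation-invariant kernel times the weight `‖u − x‖₂²` is translation invariant. [folklore] -/
theorem isTransInv_wt13_mul {M : Site d → Site d → Site d → Site d → ℝ≥0∞} (hM : IsTransInv M) :
    IsTransInv (fun u v x y => wt (u - x) * M u v x y) := by
  intro g u v x y
  simp only [hM g, add_sub_add_right_eq_sub]

/-- A translation-invariant kernel times the weight `‖v − y‖₂²` is translation invariant. [folklore] -/
theorem isTransInv_wt24_mul {M : Site d → Site d → Site d → Site d → ℝ≥0∞} (hM : IsTransInv M) :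
    IsTransInv (fun u v x y => wt (v - y) * M u v x y) := by
  intro g u v x y
  simp only [hM g, add_sub_add_right_eq_sub]

/-! ### B. `H^{(1)}`, `H^{(2)}`, `H^{(3)}` -/

/-- A direction-free family of four-point blocks indexed by `a, b ∈ {0,1,2}` (the shape of the print's `Ā^{a,b}` in
`H^{(1)}`, reading note (g)). [cite: FitznerVanDerHofstad2017, App. B (arXiv:1506.07977v2 TeX l.10611)] -/
abbrev PlainBlockFamily (d : ℕ) : Type := Fin 3 → Fin 3 → Site d → Site d → Site d → Site d → ℝ≥0∞

/-- **`H^{(1),a,b}(u,v,x,y) = ‖u−x‖₂² Ā^{a,b}(u,v,x,y)`**, with `Ā^{a,b}` a parameter (reading note (g)).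
[cite: FitznerVanDerHofstad2017, App. B "Building blocks with weight" (arXiv:1506.07977v2 TeX l.10611)] -/
def blockH1 (Abar0 : PlainBlockFamily d) (a b : Fin 3) (u v x y : Site d) : ℝ≥0∞ :=
  wt (u - x) * Abar0 a b u v x y

/-- **`H^{(2),ι,a,b}(u,v,x,y) = ‖u−x‖₂² Ā^{ι,a,b,*}(u,v,x,y)`**.
[cite: FitznerVanDerHofstad2017, App. B "Building blocks with weight" (arXiv:1506.07977v2 TeX l.10612)] -/
def blockH2 (L : Letters d) (ι : Fin d × Bool) (a b : Fin 3) (u v x y : Site d) : ℝ≥0∞ :=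
  wt (u - x) * blockAbarSt L ι a b u v x y

/-- **`H^{(3),ι,a,b}(u,v,x,y) = ‖v−y‖₂² Ā^{ι,a,b,*}(u,v,x,y)`**.
[cite: FitznerVanDerHofstad2017, App. B "Building blocks with weight" (arXiv:1506.07977v2 TeX l.10613)] -/
def blockH3 (L : Letters d) (ι : Fin d × Bool) (a b : Fin 3) (u v x y : Site d) : ℝ≥0∞ :=
  wt (v - y) * blockAbarSt L ι a b u v x y

/-- `H^{(1),a,b}` is translation invariant when `Ā^{a,b}` is. [folklore] -/
theorem isTransInv_blockH1 {Abar0 : PlainBlockFamily d} (h : ∀ a b, IsTransInv (Abar0 a b)) (a b : Fin 3) :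
    IsTransInv (blockH1 Abar0 a b) :=
  isTransInv_wt13_mul (h a b)

/-- `H^{(2),ι,a,b}` is translation invariant. [folklore] -/
theorem isTransInv_blockH2 (L : Letters d) (ι : Fin d × Bool) (a b : Fin 3) : IsTransInv (blockH2 L ι a b) :=
  isTransInv_wt13_mul (isTransInv_blockAbarSt L ι a b)

/-- `H^{(3),ι,a,b}` is translation invariant. [folklore] -/
theorem isTransInv_blockH3 (L : Letters d) (ι : Fin d × Bool) (a b : Fin 3) : IsTransInv (blockH3 L ι a b) :=
  isTransInv_wt24_mul (isTransInv_blockAbarSt L ι a b)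

/-- `H^{(2),ι,a,b}(u,v,u,y) = 0` (zero weight). [folklore] -/
theorem blockH2_diag (L : Letters d) (ι : Fin d × Bool) (a b : Fin 3) (u v y : Site d) :
    blockH2 L ι a b u v u y = 0 := by
  simp [blockH2]

/-- `H^{(3),ι,a,b}(u,v,x,v) = 0` (zero weight). [folklore] -/
theorem blockH3_diag (L : Letters d) (ι : Fin d × Bool) (a b : Fin 3) (u v x : Site d) :
    blockH3 L ι a b u v x v = 0 := by
  simp [blockH3]

/-! ### C. `C^{(1)}`, `C^{(2)}` -/

/-- The `0`-anchored base of `C^{(1),ι,κ,a,b}`: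
`C^{(1),ι,κ,a,b}(0,v,x,y) = Σ_{c} Σ_{w,u} B^{ι,a,c}(0,v,w,u) Ā^{κ,c,b}(u,w,y,x) ‖w‖₂²` (argument orders as printed,
reading note (i)). [cite: FitznerVanDerHofstad2017, App. B (B.x) "DefBlockc1-Percolation" (arXiv:1506.07977v2 TeX l.10616–10618)] -/
def blockC1₀ (L : Letters d) (B2 : DirBlockFamily d) (ι κ : Fin d × Bool) (a b : Fin 3) (v x y : Site d) : ℝ≥0∞ :=
  ∑ c : Fin 3, ∑' w : Site d, ∑' u : Site d, blockB L B2 ι a c 0 v w u * blockAbar L κ c b u w y x * wt w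

/-- **`C^{(1),ι,κ,a,b}`** (translation-invariant extension of its `0`-anchored base).
[cite: FitznerVanDerHofstad2017, App. B "DefBlockc1-Percolation" (arXiv:1506.07977v2 TeX l.10616–10618)] -/
def blockC1 (L : Letters d) (B2 : DirBlockFamily d) (ι κ : Fin d × Bool) (a b : Fin 3) :
    Site d → Site d → Site d → Site d → ℝ≥0∞ :=
  ofBase (blockC1₀ L B2 ι κ a b)

/-- The `0`-anchored base of `C^{(2),ι,κ,a,b}`:
`C^{(2),ι,κ,a,b}(0,v,x,y) = Σ_{c} Σ_{w,u} B^{ι,a,c}(v,0,u,w) Ā^{κ,c,b}(w,u,x,y) ‖u‖₂²` (argument orders as printed,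
reading note (i)). [cite: FitznerVanDerHofstad2017, App. B "DefBlockc1-Percolation-two" (arXiv:1506.07977v2 TeX l.10619–10621)] -/
def blockC2₀ (L : Letters d) (B2 : DirBlockFamily d) (ι κ : Fin d × Bool) (a b : Fin 3) (v x y : Site d) : ℝ≥0∞ :=
  ∑ c : Fin 3, ∑' w : Site d, ∑' u : Site d, blockB L B2 ι a c v 0 u w * blockAbar L κ c b w u x y * wt u

/-- **`C^{(2),ι,κ,a,b}`** (translation-invariant extension of its `0`-anchored base).
[cite: FitznerVanDerHofstad2017, App. B "DefBlockc1-Percolation-two" (arXiv:1506.07977v2 TeX l.10619–10621)] -/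
def blockC2 (L : Letters d) (B2 : DirBlockFamily d) (ι κ : Fin d × Bool) (a b : Fin 3) :
    Site d → Site d → Site d → Site d → ℝ≥0∞ :=
  ofBase (blockC2₀ L B2 ι κ a b)

/-- `C^{(1),ι,κ,a,b}` is translation invariant. [folklore] -/
theorem isTransInv_blockC1 (L : Letters d) (B2 : DirBlockFamily d) (ι κ : Fin d × Bool) (a b : Fin 3) :
    IsTransInv (blockC1 L B2 ι κ a b) :=
  isTransInv_ofBase _

/-- `C^{(2),ι,κ,a,b}` is translation invariant. [folklore] -/
theorem isTransInv_blockC2 (L : Letters d) (B2 : DirBlockFamily d) (ι κ : Fin d × Bool) (a b : Fin 3) :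
    IsTransInv (blockC2 L B2 ι κ a b) :=
  isTransInv_ofBase _

/-- `C^{(1)}` at anchor `0` is its printed base. [folklore] -/
theorem blockC1_zero (L : Letters d) (B2 : DirBlockFamily d) (ι κ : Fin d × Bool) (a b : Fin 3) (v x y : Site d) :
    blockC1 L B2 ι κ a b 0 v x y = blockC1₀ L B2 ι κ a b v x y := by
  simp [blockC1, ofBase]

/-- `C^{(2)}` at anchor `0` is its printed base. [folklore] -/
theorem blockC2_zero (L : Letters d) (B2 : DirBlockFamily d) (ι κ : Fin d × Bool) (a b : Fin 3) (v x y : Site d) :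
    blockC2 L B2 ι κ a b 0 v x y = blockC2₀ L B2 ι κ a b v x y := by
  simp [blockC2, ofBase]

/-! ### D. `h^{ι,κ,b}` and `h^{ι,κ,II,b}` -/

/-- The Kronecker prefactor `δ_{0,a} δ_{κ,ι} δ_{0,u} δ_{0,v}` of `h^{ι,κ,b}`. [cite: FitznerVanDerHofstad2017, §5.1 "Elements of the bounds", display for `h^{ι,κ,b}` (arXiv:1506.07977v2 p. 49)] -/
def kdeltaPref (ι κ : Fin d × Bool) (a : Fin 3) (u v : Site d) : ℝ≥0∞ :=
  (if a = 0 then 1 else 0) * (if κ = ι then 1 else 0) * kd 0 u * kd 0 v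

/-- `kdeltaPref ≤ 1`. [folklore] -/
theorem kdeltaPref_le_one (ι κ : Fin d × Bool) (a : Fin 3) (u v : Site d) : kdeltaPref ι κ a u v ≤ 1 := by
  unfold kdeltaPref
  refine mul_le_one' (mul_le_one' (mul_le_one' ?_ ?_) (kd_le_one _ _)) (kd_le_one _ _) <;> split_ifs <;> simp

/-- **`h^{ι,κ,b}(x,y) = Σ_a Σ_{u,v} (δ_{0,a} δ_{κ,ι} δ_{0,u} δ_{0,v} + P^{ι,a}(u,v)) Ā^{κ,a,b}(u,v,x,y) ‖x − e_ι‖₂²`**.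
[cite: FitznerVanDerHofstad2017, §5.1 "Elements of the bounds", display for `h^{ι,κ,b}` (arXiv:1506.07977v2 p. 49)] -/
def hBlock (L : Letters d) (ι κ : Fin d × Bool) (b : Fin 3) (x y : Site d) : ℝ≥0∞ :=
  ∑ a : Fin 3, ∑' u : Site d, ∑' v : Site d,
    (kdeltaPref ι κ a u v + blockPiota L ι a u v) * blockAbar L κ a b u v x y * wt (x - 𝐞 ι)

/-- **`h^{ι,κ,II,b}(x,y)`** = `h^{ι,κ,b}(x,y) + Σ_c Σ_{w,t} A^{ι,0,c}(0,0,w,t) Σ_{κ₂} Ā^{κ₂,c,b,*}(t,w,y,x) ‖x−e_ι‖₂²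
+ Σ_{a,c} Σ_{u,v,w,t} P^{ι,a}(u,v) A^{κ,a,c}(u,v,w,t) Σ_{κ₂} Ā^{κ₂,c,b,*}(t,w,y,x) ‖x−e_ι‖₂²` (reading note (k)).
[cite: FitznerVanDerHofstad2017, §5.1 (5.7) "defHiotaII" (arXiv:1506.07977v2 p. 49)] -/
def hBlockII (L : Letters d) (ι κ : Fin d × Bool) (b : Fin 3) (x y : Site d) : ℝ≥0∞ :=
  hBlock L ι κ b x y
  + ∑ c : Fin 3, ∑' w : Site d, ∑' t : Site d,
      blockAiota L ι 0 c 0 0 w t * (∑ κ₂ : Fin d × Bool, blockAbarSt L κ₂ c b t w y x) * wt (x - 𝐞 ι)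
  + ∑ a : Fin 3, ∑ c : Fin 3, ∑' u : Site d, ∑' v : Site d, ∑' w : Site d, ∑' t : Site d,
      blockPiota L ι a u v * blockAiota L κ a c u v w t *
        (∑ κ₂ : Fin d × Bool, blockAbarSt L κ₂ c b t w y x) * wt (x - 𝐞 ι)

/-- `h^{ι,κ,b} ≤ h^{ι,κ,II,b}` pointwise. [cite: FitznerVanDerHofstad2017, §5.1 (5.7) (arXiv:1506.07977v2 p. 49)] -/
theorem hBlock_le_hBlockII (L : Letters d) (ι κ : Fin d × Bool) (b : Fin 3) (x y : Site d) :
    hBlock L ι κ b x y ≤ hBlockII L ι κ b x y := by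
  unfold hBlockII
  rw [add_assoc]
  exact le_self_add

/-! ### E. Matrices and vectors -/

/-- The norm `sup_{v,y} Σ_x M(0,v,x+y,y)` — the argument pattern of `(H^{(3)})_{a,b}` (reading note (j)).
[cite: FitznerVanDerHofstad2017, §5.1 "Elements of the bounds", entry `(H^{(3)})_{a,b}` (arXiv:1506.07977v2 p. 50)] -/
def normOW (M : Site d → Site d → Site d → Site d → ℝ≥0∞) : ℝ≥0∞ := ⨆ v : Site d, ⨆ y : Site d, ∑' x : Site d, M 0 v (x + y) y

/-- **`(C^{(1)})_{a,b} = sup_{v,y} Σ_{ι,κ,x} C^{(1),ι,κ,a,b}(0,v,x,x+y)`**.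
[cite: FitznerVanDerHofstad2017, §5.1 "Elements of the bounds" (arXiv:1506.07977v2 p. 50)] -/
def matC1 (L : Letters d) (B2 : DirBlockFamily d) : Matrix (Fin 3) (Fin 3) ℝ≥0∞ :=
  Matrix.of fun a b => normOO (fun u v x y => ∑ ι : Fin d × Bool, ∑ κ : Fin d × Bool, blockC1 L B2 ι κ a b u v x y)

/-- **`(C^{(2)})_{a,b} = sup_{v,y} Σ_{ι,κ,x} C^{(2),ι,κ,a,b}(0,v,x,x+y)`**.
[cite: FitznerVanDerHofstad2017, §5.1 "Elements of the bounds" (arXiv:1506.07977v2 p. 50)] -/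
def matC2 (L : Letters d) (B2 : DirBlockFamily d) : Matrix (Fin 3) (Fin 3) ℝ≥0∞ :=
  Matrix.of fun a b => normOO (fun u v x y => ∑ ι : Fin d × Bool, ∑ κ : Fin d × Bool, blockC2 L B2 ι κ a b u v x y)

/-- **`(H^{(1)})_{a,b} = sup_{v,y} Σ_x H^{(1),a,b}(0,v,x,x+y)`** (with the parameter `Ā^{a,b}`, reading note (g)).
[cite: FitznerVanDerHofstad2017, §5.1 "Elements of the bounds" (arXiv:1506.07977v2 p. 50)] -/
def matH1 (Abar0 : PlainBlockFamily d) : Matrix (Fin 3) (Fin 3) ℝ≥0∞ :=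
  Matrix.of fun a b => normOO (blockH1 Abar0 a b)

/-- **`(H^{(2)})_{a,b} = sup_{v,y} Σ_{ι,x} H^{(2),ι,a,b}(0,v,x,x+y)`**.
[cite: FitznerVanDerHofstad2017, §5.1 "Elements of the bounds" (arXiv:1506.07977v2 p. 50)] -/
def matH2 (L : Letters d) : Matrix (Fin 3) (Fin 3) ℝ≥0∞ := matAbar (blockH2 L)

/-- **`(H^{(3)})_{a,b} = sup_{v,y} Σ_{ι,x} H^{(3),ι,a,b}(0,v,x+y,y)`** (argument pattern as printed, reading note (j)).
[cite: FitznerVanDerHofstad2017, §5.1 "Elements of the bounds" (arXiv:1506.07977v2 p. 50)] -/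
def matH3 (L : Letters d) : Matrix (Fin 3) (Fin 3) ℝ≥0∞ :=
  Matrix.of fun a b => normOW (fun u v x y => ∑ ι : Fin d × Bool, blockH3 L ι a b u v x y)

/-- **`(h^S)_b = (H^{(1)})_{0,b}`** (row vector). [cite: FitznerVanDerHofstad2017, §5.1 "Elements of the bounds" (arXiv:1506.07977v2 p. 50)] -/
def vechS (Abar0 : PlainBlockFamily d) : Fin 3 → ℝ≥0∞ := fun b => matH1 Abar0 0 b

/-- **`(h^E)_b = (H^{(3)})_{0,b}`** (column vector). [cite: FitznerVanDerHofstad2017, §5.1 "Elements of the bounds" (arXiv:1506.07977v2 p. 50)] -/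
def vechE (L : Letters d) : Fin 3 → ℝ≥0∞ := fun b => matH3 L 0 b

/-- The prefactor `1/(2d)`. [cite: FitznerVanDerHofstad2017, §5.1 "Elements of the bounds" (arXiv:1506.07977v2 p. 50)] -/
def invTwoD (d : ℕ) : ℝ≥0∞ := (2 * (d : ℝ≥0∞))⁻¹

/-- **`(P^ι)_b = (1/2d)[δ_{0,b} + Σ_{ι,x,y} P^{ι,b}(x,y)]`** (`vecPiotaSum` of `NobleBlocks` is the triple sum).
[cite: FitznerVanDerHofstad2017, §5.1 "Elements of the bounds" (arXiv:1506.07977v2 p. 50)] -/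
def vecPiota (L : Letters d) : Fin 3 → ℝ≥0∞ :=
  fun b => invTwoD d * ((if b = 0 then 1 else 0) + vecPiotaSum L b)

/-- **`(h^ι)_b = (1/2d) Σ_{ι,κ,x,y} h^{ι,κ,b}(x,y)`**. [cite: FitznerVanDerHofstad2017, §5.1 "Elements of the bounds" (arXiv:1506.07977v2 p. 50)] -/
def vechIota (L : Letters d) : Fin 3 → ℝ≥0∞ :=
  fun b => invTwoD d * ∑ ι : Fin d × Bool, ∑ κ : Fin d × Bool, pairSum (hBlock L ι κ b)

/-- **`(h^{ι,II})_b = (1/2d) Σ_{ι,κ,x,y} h^{ι,κ,II,b}(x,y)`**. [cite: FitznerVanDerHofstad2017, §5.1 "Elements of the bounds" (arXiv:1506.07977v2 p. 50)] -/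
def vechIotaII (L : Letters d) : Fin 3 → ℝ≥0∞ :=
  fun b => invTwoD d * ∑ ι : Fin d × Bool, ∑ κ : Fin d × Bool, pairSum (hBlockII L ι κ b)

/-- Entries of `(C^{(1)})` at the printed anchor. [folklore] -/
theorem matC1_apply (L : Letters d) (B2 : DirBlockFamily d) (a b : Fin 3) :
    matC1 L B2 a b = ⨆ v : Site d, ⨆ y : Site d, ∑' x : Site d,
      ∑ ι : Fin d × Bool, ∑ κ : Fin d × Bool, blockC1₀ L B2 ι κ a b v x (x + y) := by
  simp [matC1, normOO, blockC1_zero]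

/-- Entries of `(C^{(2)})` at the printed anchor. [folklore] -/
theorem matC2_apply (L : Letters d) (B2 : DirBlockFamily d) (a b : Fin 3) :
    matC2 L B2 a b = ⨆ v : Site d, ⨆ y : Site d, ∑' x : Site d,
      ∑ ι : Fin d × Bool, ∑ κ : Fin d × Bool, blockC2₀ L B2 ι κ a b v x (x + y) := by
  simp [matC2, normOO, blockC2_zero]

/-- Entries of `(H^{(2)})`. [folklore] -/
theorem matH2_apply (L : Letters d) (a b : Fin 3) :
    matH2 L a b = ⨆ v : Site d, ⨆ y : Site d, ∑' x : Site d, ∑ ι : Fin d × Bool, blockH2 L ι a b 0 v x (x + y) := by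
  simp [matH2, matAbar, normOO]

/-- Entries of `(H^{(3)})`. [folklore] -/
theorem matH3_apply (L : Letters d) (a b : Fin 3) :
    matH3 L a b = ⨆ v : Site d, ⨆ y : Site d, ∑' x : Site d, ∑ ι : Fin d × Bool, blockH3 L ι a b 0 v (x + y) y := by
  simp [matH3, normOW]

/-- `(h^ι)_b ≤ (h^{ι,II})_b`. [cite: FitznerVanDerHofstad2017, §5.1 (5.7) (arXiv:1506.07977v2 p. 49)] -/
theorem vechIota_le_vechIotaII (L : Letters d) (b : Fin 3) : vechIota L b ≤ vechIotaII L b := by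
  unfold vechIota vechIotaII
  refine mul_le_mul' le_rfl (Finset.sum_le_sum fun ι _ => Finset.sum_le_sum fun κ _ => ?_)
  exact ENNReal.tsum_le_tsum fun x => ENNReal.tsum_le_tsum fun y => hBlock_le_hBlockII L ι κ b x y

end Literature.Probability.FitznerVanDerHofstad2017.NobleBlocks

end
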